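import Mathlib
import HarnessLib
import Summits.Ventures.LatticeQCDFlow.Exactness.PTBCSwapErgodic
import Summits.Ventures.LatticeQCDFlow.Exactness.PTBCSwap

/-!
# The PTBC translation move, lifted, is exact: the full PTBC cycle (heat baths, swaps, translation) is uniformly ergodic

HONEST FRAMING: exact (Metropolis-corrected) sampling algorithms for lattice gauge theory;
figures of merit are autocorrelation/cost numbers at stated couplings and volumes; no
continuum-physics claim.

Venture `LatticeQCDFlow` (cell pub-lqcd), topic `Exactness`, FANOUT row 9 (eng-latcore, the
engine `latflow.core.ptbc`: after the swaps, the periodic replica `r₀` is translated by a lattice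
shift — accepted with probability one because its action is translation invariant).  NEW WORK of
the cell over the tree (`PTBCSwap.lean`: `measurePreserving_withDensity_of_actionInvariant` — a
`vol`-preserving bijection fixing the action preserves `e^{−S} vol`; `ReplicaProductInvariant.lean`:
`invariant_pi_replicaLift`; `PTBCSwapErgodic.lean`: the lifted swaps are exact, `ptbc_uniformlyErgodic`;
`PTBCHeatBathErgodic.lean`: `ptbc_heatBath_uniformlyErgodic`).  Nothing here is cited as a fact.

* `ptbcTranslationFamily T r₀` (the deterministic move `T` on replica `r₀`, identity elsewhere),
  **`ptbcTranslation T hT r₀`** (its lift to the replica product: replica `r₀ ↦ T`, the others kept);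
  `invariant_deterministic_of_measurePreserving`; **`ptbcTranslation_invariant_ptbcTarget`** — if `T`
  is a measurable bijection of one replica's configurations preserving `⊗μ` and the action `S r₀`
  (`S r₀ ∘ T = S r₀`), its lift is EXACT for the product of the tempered Gibbs laws.
* **`ptbc_full_uniformlyErgodic`**, **`ptbcTarget_unique_invariant_full`** — THE FULL PTBC CYCLE
  `(translation ∘ₖ swaps) ∘ₖ (heat-bath scans on every replica)` for bounded measurable actions
  `a ≤ S q ≤ b`: `|μ₀ Cᵗ(A) − ptbcTarget(A)| ≤ (1 − ((e^{−b}/e^{−a})^{|l|})^{|L|})ᵗ` from EVERY initial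
  law; the product of the tempered Gibbs laws is the ONLY invariant probability law;
  **`ptbc_uniformlyErgodic_of_inReplica`** — the same for ANY family of in-replica Markov updates that
  are Doeblin w.r.t. `⊗μ` and exact for their tempered laws (the `SU(N)` Cabibbo–Marinari sweeps of
  `CabibboMarinariLatticeErgodic.lean`).

NOT CLAIMED: that the engine's shift IS such a `T` for the defect-free replica (a permutation of the
edges preserving product Haar and the periodic Wilson action — true, not typed here: no weighted
Wilson action in Literature); swap acceptance / round-trip statistics; rates.
-/

noncomputable section

namespace Summit.Ventures.LatticeQCDFlow.Exactness

open MeasureTheory ProbabilityTheory Set Function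
open scoped ENNReal

section Translation

variable {R : Type*} [DecidableEq R] {Ω : Type*} [MeasurableSpace Ω]

/-- The family "`T` on replica `r₀`, identity elsewhere" of in-replica deterministic kernels. -/
def ptbcTranslationFamily (T : Ω → Ω) (hT : Measurable T) (r₀ : R) (r : R) : Kernel Ω Ω :=
  if r = r₀ then Kernel.deterministic T hT else Kernel.id

/-- Every member of the family is Markov. -/
instance isMarkovKernel_ptbcTranslationFamily (T : Ω → Ω) (hT : Measurable T) (r₀ r : R) :
    IsMarkovKernel (ptbcTranslationFamily T hT r₀ r) := by
  unfold ptbcTranslationFamily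
  split_ifs <;> infer_instance

/-- **The lifted translation**: apply `T` to replica `r₀`, keep the others. -/
def ptbcTranslation (T : Ω → Ω) (hT : Measurable T) (r₀ : R) : Kernel (R → Ω) (R → Ω) :=
  replicaLift (ptbcTranslationFamily T hT r₀) r₀

/-- The lifted translation is Markov. -/
instance isMarkovKernel_ptbcTranslation (T : Ω → Ω) (hT : Measurable T) (r₀ : R) :
    IsMarkovKernel (ptbcTranslation T hT r₀) := by
  unfold ptbcTranslation; infer_instance

omit [DecidableEq R] in
/-- A measure-preserving map, as a deterministic kernel, leaves the measure invariant. -/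
theorem invariant_deterministic_of_measurePreserving {T : Ω → Ω} {ν : Measure Ω}
    (hT : MeasurePreserving T ν ν) : Kernel.Invariant (Kernel.deterministic T hT.measurable) ν := by
  change ν.bind ⇑(Kernel.deterministic T hT.measurable) = ν
  rw [Measure.deterministic_comp_eq_map, hT.map_eq]

end Translation

section Target

variable {R : Type*} [DecidableEq R] [Fintype R] {ι : Type*} [Fintype ι] {X : ι → Type*}
  [∀ j, MeasurableSpace (X j)] {μ : ∀ j, Measure (X j)} [∀ j, IsProbabilityMeasure (μ j)]
  {S : R → (∀ j, X j) → ℝ}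

/-- **THE LIFTED TRANSLATION IS EXACT FOR THE PRODUCT OF THE TEMPERED GIBBS LAWS**: `T` a measurable
bijection of one replica's configurations preserving `⊗μ` and the action of replica `r₀`. -/
theorem ptbcTranslation_invariant_ptbcTarget (hS : ∀ q, Measurable (S q)) {a b : ℝ}
    (hab : ∀ q ω, a ≤ S q ω ∧ S q ω ≤ b) (T : (∀ j, X j) ≃ᵐ (∀ j, X j))
    (hT : MeasurePreserving T (Measure.pi μ) (Measure.pi μ)) (r₀ : R) (hST : ∀ ω, S r₀ (T ω) = S r₀ ω) :
    Kernel.Invariant (ptbcTranslation T T.measurable r₀) (ptbcTarget μ (ptbcDensity S)) := by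
  haveI : ∀ q, IsProbabilityMeasure (piGibbsLaw μ (ptbcDensity S q)) := fun q =>
    isProbabilityMeasure_piGibbsLaw (μ := μ) (p := ptbcDensity S q)
      (by rw [Ne, ENNReal.ofReal_eq_zero, not_le]; exact Real.exp_pos (-b)) ENNReal.ofReal_ne_top
      (fun ω => (ptbcDensity_pinched hab q ω).1) (fun ω => (ptbcDensity_pinched hab q ω).2)
  refine invariant_pi_replicaLift (K := ptbcTranslationFamily T T.measurable r₀)
    (π := fun q => piGibbsLaw μ (ptbcDensity S q)) (fun r => ?_) r₀
  unfold ptbcTranslationFamily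
  split_ifs with h
  · subst h
    -- `T` preserves `e^{−S_{r₀}} ⊗μ`, hence `Z⁻¹ e^{−S_{r₀}} ⊗μ`
    have hpres : MeasurePreserving T (piGibbsLaw μ (ptbcDensity S r)) (piGibbsLaw μ (ptbcDensity S r)) := by
      unfold piGibbsLaw ptbcDensity
      exact (measurePreserving_withDensity_of_actionInvariant T hT (hS r) hST).smul_measure _
    exact invariant_deterministic_of_measurePreserving hpres
  · exact invariant_id

variable [DecidableEq ι]

/-- **THE FULL PTBC CYCLE IS UNIFORMLY ERGODIC**: heat-bath scans on every replica (bounded measurable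
actions `a ≤ S q ≤ b`), then the swaps along any list of pairs, then the translation of replica `r₀`
by a `⊗μ`-preserving, `S r₀`-preserving measurable bijection `T`:
`|μ₀ Cᵗ(A) − ptbcTarget(A)| ≤ (1 − ((e^{−b}/e^{−a})^{|l|})^{|L|})ᵗ` for every initial law `μ₀`. -/
theorem ptbc_full_uniformlyErgodic (hS : ∀ q, Measurable (S q)) {a b : ℝ}
    (hab : ∀ q ω, a ≤ S q ω ∧ S q ω ≤ b) {l : List ι} (hl : ∀ j, j ∈ l) {L : List R} (hL : ∀ r, r ∈ L)
    (P : List (R × R)) (T : (∀ j, X j) ≃ᵐ (∀ j, X j)) (hT : MeasurePreserving T (Measure.pi μ) (Measure.pi μ))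
    (r₀ : R) (hST : ∀ ω, S r₀ (T ω) = S r₀ ω)
    (μ₀ : Measure (R → ∀ j, X j)) [IsProbabilityMeasure μ₀] (t : ℕ) (A : Set (R → ∀ j, X j)) :
    |((fun ν : Measure (R → ∀ j, X j) =>
          ν.bind ((ptbcTranslation T T.measurable r₀ ∘ₖ ptbcSwaps S P) ∘ₖ
            replicaSweep (ptbcInReplica μ (ptbcDensity S) l) L))^[t] μ₀).real A
        - (ptbcTarget μ (ptbcDensity S)).real A| ≤
      (1 - (((ENNReal.ofReal (Real.exp (-b)) * (ENNReal.ofReal (Real.exp (-a)))⁻¹) ^ l.length) ^ L.length).toReal) ^ t := by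
  haveI := isMarkovKernel_ptbcSwaps (S := S) hS P
  exact ptbc_heatBath_uniformlyErgodic (μ := μ) (p := ptbcDensity S) (measurable_ptbcDensity hS)
    (by rw [Ne, ENNReal.ofReal_eq_zero, not_le]; exact Real.exp_pos (-b)) ENNReal.ofReal_ne_top
    (fun q ω => (ptbcDensity_pinched hab q ω).1) (fun q ω => (ptbcDensity_pinched hab q ω).2) hl hL
    (ptbcTranslation T T.measurable r₀ ∘ₖ ptbcSwaps S P)
    ((ptbcTranslation_invariant_ptbcTarget hS hab T hT r₀ hST).comp (ptbcSwaps_invariant_ptbcTarget hS hab P))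
    μ₀ t A

/-- **… and the product of the tempered Gibbs laws is its ONLY invariant probability law.** -/
theorem ptbcTarget_unique_invariant_full (hS : ∀ q, Measurable (S q)) {a b : ℝ}
    (hab : ∀ q ω, a ≤ S q ω ∧ S q ω ≤ b) {l : List ι} (hl : ∀ j, j ∈ l) {L : List R} (hL : ∀ r, r ∈ L)
    (P : List (R × R)) (T : (∀ j, X j) ≃ᵐ (∀ j, X j)) (hT : MeasurePreserving T (Measure.pi μ) (Measure.pi μ))
    (r₀ : R) (hST : ∀ ω, S r₀ (T ω) = S r₀ ω) {Q : Measure (R → ∀ j, X j)} [IsProbabilityMeasure Q]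
    (hQ : Kernel.Invariant ((ptbcTranslation T T.measurable r₀ ∘ₖ ptbcSwaps S P) ∘ₖ
      replicaSweep (ptbcInReplica μ (ptbcDensity S) l) L) Q) :
    Q = ptbcTarget μ (ptbcDensity S) := by
  haveI := isMarkovKernel_ptbcSwaps (S := S) hS P
  exact ptbcTarget_unique_invariant (μ := μ) (p := ptbcDensity S) (measurable_ptbcDensity hS)
    (by rw [Ne, ENNReal.ofReal_eq_zero, not_le]; exact Real.exp_pos (-b)) ENNReal.ofReal_ne_top
    (fun q ω => (ptbcDensity_pinched hab q ω).1) (fun q ω => (ptbcDensity_pinched hab q ω).2) hl hL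
    (ptbcTranslation T T.measurable r₀ ∘ₖ ptbcSwaps S P)
    ((ptbcTranslation_invariant_ptbcTarget hS hab T hT r₀ hST).comp (ptbcSwaps_invariant_ptbcTarget hS hab P)) hQ

omit [DecidableEq ι] in
/-- **ANY DOEBLIN EXACT IN-REPLICA UPDATES** (e.g. the `SU(N)` Cabibbo–Marinari pseudo-heat-bath sweeps
of `CabibboMarinariLatticeErgodic.lean`, Doeblin by `latSweep_minorised` and exact by
`latSweep_invariant_piGibbsLaw`): if every `K r` dominates `ε · ⊗μ` from every state and leaves
`Z_r⁻¹e^{−S_r}·⊗μ` invariant, the PTBC cycle `(translation ∘ₖ swaps) ∘ₖ replicaSweep K L` converges to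
the product of the tempered Gibbs laws from every start, `|μ₀ Cᵗ(A) − ptbcTarget(A)| ≤ (1 − ε^{|L|})ᵗ`,
and that law is its only invariant probability law. -/
theorem ptbc_uniformlyErgodic_of_inReplica (hS : ∀ q, Measurable (S q)) {a b : ℝ}
    (hab : ∀ q ω, a ≤ S q ω ∧ S q ω ≤ b) {K : R → Kernel (∀ j, X j) (∀ j, X j)} [∀ r, IsMarkovKernel (K r)]
    {ε : ℝ≥0∞} (hK : ∀ r x, ε • Measure.pi μ ≤ K r x) (hε : 0 < ε)
    (hKinv : ∀ r, Kernel.Invariant (K r) (piGibbsLaw μ (ptbcDensity S r))) {L : List R} (hL : ∀ r, r ∈ L)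
    (P : List (R × R)) (T : (∀ j, X j) ≃ᵐ (∀ j, X j)) (hT : MeasurePreserving T (Measure.pi μ) (Measure.pi μ))
    (r₀ : R) (hST : ∀ ω, S r₀ (T ω) = S r₀ ω) :
    (∀ (μ₀ : Measure (R → ∀ j, X j)) [IsProbabilityMeasure μ₀] (t : ℕ) (A : Set (R → ∀ j, X j)),
      |((fun ν : Measure (R → ∀ j, X j) =>
            ν.bind ((ptbcTranslation T T.measurable r₀ ∘ₖ ptbcSwaps S P) ∘ₖ replicaSweep K L))^[t] μ₀).real A
          - (ptbcTarget μ (ptbcDensity S)).real A| ≤ (1 - (ε ^ L.length).toReal) ^ t) ∧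
    ∀ (Q : Measure (R → ∀ j, X j)) [IsProbabilityMeasure Q],
      Kernel.Invariant ((ptbcTranslation T T.measurable r₀ ∘ₖ ptbcSwaps S P) ∘ₖ replicaSweep K L) Q →
        Q = ptbcTarget μ (ptbcDensity S) := by
  haveI := isMarkovKernel_ptbcSwaps (S := S) hS P
  haveI : ∀ q, IsProbabilityMeasure (piGibbsLaw μ (ptbcDensity S q)) := fun q =>
    isProbabilityMeasure_piGibbsLaw (μ := μ) (p := ptbcDensity S q)
      (by rw [Ne, ENNReal.ofReal_eq_zero, not_le]; exact Real.exp_pos (-b)) ENNReal.ofReal_ne_top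
      (fun ω => (ptbcDensity_pinched hab q ω).1) (fun ω => (ptbcDensity_pinched hab q ω).2)
  have hη : Kernel.Invariant (ptbcTranslation T T.measurable r₀ ∘ₖ ptbcSwaps S P) (ptbcTarget μ (ptbcDensity S)) :=
    (ptbcTranslation_invariant_ptbcTarget hS hab T hT r₀ hST).comp (ptbcSwaps_invariant_ptbcTarget hS hab P)
  refine ⟨fun μ₀ _ t A => ?_, fun Q _ hQ => ?_⟩
  · exact replicaCycle_convergesTo_pi (K := K) (ν := fun _ : R => Measure.pi μ)
      (π := fun q => piGibbsLaw μ (ptbcDensity S q)) hK hKinv hL _ hη μ₀ t A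
  · exact pi_unique_invariant_replicaCycle (K := K) (ν := fun _ : R => Measure.pi μ)
      (π := fun q => piGibbsLaw μ (ptbcDensity S q)) hK hε hKinv hL _ hη hQ

end Target

end Summit.Ventures.LatticeQCDFlow.Exactness
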